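import Mathlib.MeasureTheory.Integral.Bochner.Set
import Mathlib.MeasureTheory.Measure.Lebesgue.Basic
import Mathlib.Algebra.BigOperators.Finprod
import Literature.Analysis.FluidPDE.HardSphereCollisionRecord
import HarnessLib

/-!
# Offset averaging of windowed sums: a sum over event times is the average over the window offset
# of the sums over sliding windows of fixed length
(Cercignani–Illner–Pulvirenti 1994, §4.4 p. 86: the time axis `[0, τ]` of the hard-sphere gas is cut into windows of a
fraction of the mean free time, inside which the dynamics is a finite-body functional of the configuration at the window start;
trunk T-KINETIC, topic Analysis/FluidPDE (hard-sphere dynamics): the bookkeeping identity that makes the window decomposition of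
a collision sum EXACT, with no boundary terms, by averaging over the offset of the window grid.)

For a finite set of times `C ⊂ ℝ`, values `f : ℝ → E` in a real Banach space and a window length `Δ > 0`, every `c ∈ C`
belongs to the sliding window `(s, s + Δ]` exactly for the offsets `s ∈ [c - Δ, c)`, a set of Lebesgue measure `Δ`; hence
(Fubini for a finite sum of indicators)

  `∫ (Σ_{c ∈ C ∩ (s, s + Δ]} f c) ds = Δ • Σ_{c ∈ C} f c`,   `Σ_{c ∈ C} f c = Δ⁻¹ • ∫ (Σ_{c ∈ C ∩ (s, s + Δ]} f c) ds`

(`integral_sum_filter_mem_Ioc`, `sum_eq_inv_smul_integral_sum_filter_mem_Ioc`), and if `C ⊆ (a, b]` the offset integral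
may be taken over `s ∈ (a - Δ, b]` only (`setIntegral_sum_filter_mem_Ioc`). The same for `finsum`s over finite sets of
reals (`integral_finsum_mem_inter_Ioc`, `finsum_mem_eq_inv_smul_integral`), and — the form consumed by window arguments on
hard-sphere trajectories — for the collision pair sums of `HardSphereCollisionRecord`: with finitely many collision times in
`S`, `collisionPairSum G ε γ S g = Δ⁻¹ • ∫ collisionPairSum G ε γ (S ∩ (s, s + Δ]) g ds`
(`collisionPairSum_eq_inv_smul_integral_window`), i.e. the collision sum over `[0, τ]` is the offset average of the collision
sums over the windows `(s, s + Δ]`.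

## Mathlib reuse

`MeasureTheory.integral_finsetSum`, `MeasureTheory.integral_indicator_const`, `Real.volume_real_Ico_of_le`,
`MeasureTheory.setIntegral_eq_integral_of_forall_compl_eq_zero`, `finsum_mem_eq_finite_toFinset_sum`. Mathlib has no
sliding-window identity of this kind (grep `Ioc s (s +`, `sliding`: nothing relevant).

## References

* C. Cercignani, R. Illner, M. Pulvirenti, *The Mathematical Theory of Dilute Gases*, Springer (1994), §4.4 p. 86. [CIP1994]
-/

open MeasureTheory Set Filter Function
open scoped BigOperators

namespace Literature.Analysis.FluidPDE

noncomputable section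

section Window

variable {E : Type*} [NormedAddCommGroup E] [NormedSpace ℝ E]

/-- A time `c` lies in the sliding window `(s, s + Δ]` iff the offset `s` lies in `[c - Δ, c)`. [folklore] -/
theorem mem_Ioc_add_iff_mem_Ico_sub {s c Δ : ℝ} : c ∈ Ioc s (s + Δ) ↔ s ∈ Ico (c - Δ) c := by
  simp only [mem_Ioc, mem_Ico]
  constructor
  · rintro ⟨h1, h2⟩; exact ⟨by linarith, h1⟩
  · rintro ⟨h1, h2⟩; exact ⟨h2, by linarith⟩

omit [NormedSpace ℝ E] in
open Classical in
/-- The windowed sum as a finite sum of indicator functions of the offset. [folklore] -/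
theorem sum_filter_mem_Ioc_eq_sum_indicator (C : Finset ℝ) (f : ℝ → E) (Δ s : ℝ) :
    (∑ c ∈ C with c ∈ Ioc s (s + Δ), f c) = ∑ c ∈ C, (Ico (c - Δ) c).indicator (fun _ => f c) s := by
  rw [Finset.sum_filter]
  refine Finset.sum_congr rfl fun c _ => ?_
  by_cases h : c ∈ Ioc s (s + Δ)
  · rw [if_pos h, indicator_of_mem (mem_Ioc_add_iff_mem_Ico_sub.1 h)]
  · rw [if_neg h, indicator_of_notMem (fun h' => h (mem_Ioc_add_iff_mem_Ico_sub.2 h'))]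

omit [NormedSpace ℝ E] in
open Classical in
/-- The windowed sum vanishes for offsets `s ∉ (a - Δ, b]` when all times lie in `(a, b]`. [folklore] -/
theorem sum_filter_mem_Ioc_eq_zero_of_not_mem (C : Finset ℝ) (f : ℝ → E) {Δ a b : ℝ}
    (hC : ∀ c ∈ C, c ∈ Ioc a b) {s : ℝ} (hs : s ∉ Ioc (a - Δ) b) :
    (∑ c ∈ C with c ∈ Ioc s (s + Δ), f c) = 0 := by
  refine Finset.sum_eq_zero fun c hc => ?_
  rw [Finset.mem_filter] at hc
  obtain ⟨hcC, hcs⟩ := hc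
  exfalso
  refine hs ⟨?_, ?_⟩
  · linarith [(hC c hcC).1, hcs.2]
  · linarith [(hC c hcC).2, hcs.1]

variable [CompleteSpace E]

open Classical in
/-- **Offset averaging of a windowed sum** (the integral form): for a finite set of times `C`, `Δ ≥ 0` and any `f`,
`∫ (Σ_{c ∈ C, c ∈ (s, s + Δ]} f c) ds = Δ • Σ_{c ∈ C} f c` — every `c` is counted for the offsets `s ∈ [c - Δ, c)`, a set
of Lebesgue measure `Δ`. [folklore] -/
theorem integral_sum_filter_mem_Ioc (C : Finset ℝ) (f : ℝ → E) {Δ : ℝ} (hΔ : 0 ≤ Δ) :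
    ∫ s, (∑ c ∈ C with c ∈ Ioc s (s + Δ), f c) = Δ • ∑ c ∈ C, f c := by
  simp_rw [sum_filter_mem_Ioc_eq_sum_indicator]
  rw [integral_finsetSum _ (fun c _ => ?_), Finset.smul_sum]
  · refine Finset.sum_congr rfl fun c _ => ?_
    rw [integral_indicator_const (f c) measurableSet_Ico, Real.volume_real_Ico_of_le (by linarith)]
    congr 1
    ring
  · exact (integrable_indicator_iff measurableSet_Ico).2
      ((integrableOn_const_iff).2 (Or.inr (by rw [Real.volume_Ico]; exact ENNReal.ofReal_lt_top)))

open Classical in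
/-- **Offset averaging of a windowed sum**: for a finite set of times `C`, `Δ > 0` and any `f`,
`Σ_{c ∈ C} f c = Δ⁻¹ • ∫ (Σ_{c ∈ C, c ∈ (s, s + Δ]} f c) ds`. [cite: CIP1994, §4.4 p. 86] -/
theorem sum_eq_inv_smul_integral_sum_filter_mem_Ioc (C : Finset ℝ) (f : ℝ → E) {Δ : ℝ} (hΔ : 0 < Δ) :
    ∑ c ∈ C, f c = Δ⁻¹ • ∫ s, (∑ c ∈ C with c ∈ Ioc s (s + Δ), f c) := by
  rw [integral_sum_filter_mem_Ioc C f hΔ.le, inv_smul_smul₀ hΔ.ne']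

open Classical in
/-- **Offset averaging over a bounded range of offsets**: if all times lie in `(a, b]`, the offset integral may be restricted
to `s ∈ (a - Δ, b]`: `∫_{(a - Δ, b]} (Σ_{c ∈ C, c ∈ (s, s + Δ]} f c) ds = Δ • Σ_{c ∈ C} f c` (`Δ ≥ 0`). [folklore] -/
theorem setIntegral_sum_filter_mem_Ioc (C : Finset ℝ) (f : ℝ → E) {Δ a b : ℝ} (hΔ : 0 ≤ Δ)
    (hC : ∀ c ∈ C, c ∈ Ioc a b) :
    ∫ s in Ioc (a - Δ) b, (∑ c ∈ C with c ∈ Ioc s (s + Δ), f c) = Δ • ∑ c ∈ C, f c := by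
  rw [setIntegral_eq_integral_of_forall_compl_eq_zero (fun s hs => sum_filter_mem_Ioc_eq_zero_of_not_mem C f hC hs),
    integral_sum_filter_mem_Ioc C f hΔ]

open Classical in
/-- The bounded-range form solved for the sum: `Σ_{c ∈ C} f c = Δ⁻¹ • ∫_{(a - Δ, b]} (Σ_{c ∈ C, c ∈ (s, s + Δ]} f c) ds`
(`Δ > 0`, all times in `(a, b]`). [cite: CIP1994, §4.4 p. 86] -/
theorem sum_eq_inv_smul_setIntegral_sum_filter_mem_Ioc (C : Finset ℝ) (f : ℝ → E) {Δ a b : ℝ} (hΔ : 0 < Δ)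
    (hC : ∀ c ∈ C, c ∈ Ioc a b) :
    ∑ c ∈ C, f c = Δ⁻¹ • ∫ s in Ioc (a - Δ) b, (∑ c ∈ C with c ∈ Ioc s (s + Δ), f c) := by
  rw [setIntegral_sum_filter_mem_Ioc C f hΔ.le hC, inv_smul_smul₀ hΔ.ne']

/-! ## The same for `finsum`s over finite sets of times -/

omit [NormedSpace ℝ E] [CompleteSpace E] in
open Classical in
/-- The windowed `finsum` over a finite set of times is the filtered finite sum. [folklore] -/
theorem finsum_mem_inter_Ioc_eq_sum_filter {T : Set ℝ} (hT : T.Finite) (f : ℝ → E) (Δ s : ℝ) :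
    ∑ᶠ c ∈ T ∩ Ioc s (s + Δ), f c = ∑ c ∈ hT.toFinset with c ∈ Ioc s (s + Δ), f c := by
  rw [finsum_mem_eq_finite_toFinset_sum _ (hT.inter_of_left (Ioc s (s + Δ)))]
  congr 1
  ext c
  simp only [Finite.mem_toFinset, mem_inter_iff, Finset.mem_filter]

/-- **Offset averaging of a windowed `finsum`** (integral form): for a finite set of times `T` and `Δ ≥ 0`,
`∫ (∑ᶠ c ∈ T ∩ (s, s + Δ], f c) ds = Δ • ∑ᶠ c ∈ T, f c`. [folklore] -/
theorem integral_finsum_mem_inter_Ioc {T : Set ℝ} (hT : T.Finite) (f : ℝ → E) {Δ : ℝ} (hΔ : 0 ≤ Δ) :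
    ∫ s, (∑ᶠ c ∈ T ∩ Ioc s (s + Δ), f c) = Δ • ∑ᶠ c ∈ T, f c := by
  classical
  simp_rw [finsum_mem_inter_Ioc_eq_sum_filter hT]
  rw [integral_sum_filter_mem_Ioc _ f hΔ, finsum_mem_eq_finite_toFinset_sum _ hT]

/-- **Offset averaging of a windowed `finsum`**: for a finite set of times `T` and `Δ > 0`,
`∑ᶠ c ∈ T, f c = Δ⁻¹ • ∫ (∑ᶠ c ∈ T ∩ (s, s + Δ], f c) ds`. [cite: CIP1994, §4.4 p. 86] -/
theorem finsum_mem_eq_inv_smul_integral {T : Set ℝ} (hT : T.Finite) (f : ℝ → E) {Δ : ℝ} (hΔ : 0 < Δ) :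
    ∑ᶠ c ∈ T, f c = Δ⁻¹ • ∫ s, (∑ᶠ c ∈ T ∩ Ioc s (s + Δ), f c) := by
  rw [integral_finsum_mem_inter_Ioc hT f hΔ.le, inv_smul_smul₀ hΔ.ne']

/-- The bounded-range form for `finsum`s: if the finite set of times `T` lies in `(a, b]` and `Δ ≥ 0`,
`∫_{(a - Δ, b]} (∑ᶠ c ∈ T ∩ (s, s + Δ], f c) ds = Δ • ∑ᶠ c ∈ T, f c`. [folklore] -/
theorem setIntegral_finsum_mem_inter_Ioc {T : Set ℝ} (hT : T.Finite) (f : ℝ → E) {Δ a b : ℝ} (hΔ : 0 ≤ Δ)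
    (hTab : T ⊆ Ioc a b) :
    ∫ s in Ioc (a - Δ) b, (∑ᶠ c ∈ T ∩ Ioc s (s + Δ), f c) = Δ • ∑ᶠ c ∈ T, f c := by
  classical
  simp_rw [finsum_mem_inter_Ioc_eq_sum_filter hT]
  rw [setIntegral_sum_filter_mem_Ioc _ f hΔ (fun c hc => hTab ((Finite.mem_toFinset hT).1 hc)),
    finsum_mem_eq_finite_toFinset_sum _ hT]

end Window

/-! ## Collision pair sums of a curve in phase space: the sum over a set of times is the offset average of the sums over
sliding windows -/

section Collisions

variable {d : Type*} [Fintype d] {X : Type*} {N : ℕ} {G : Geometry d X} {ε : ℝ}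
  {E : Type*} [NormedAddCommGroup E] [NormedSpace ℝ E] [CompleteSpace E]

omit [NormedSpace ℝ E] [CompleteSpace E] in
/-- The collision pair sum over the part of `S` inside a sliding window is the windowed `finsum` of the per-time pair sums.
[folklore] -/
theorem collisionPairSum_inter_Ioc (γ : ℝ → Config N d X) (S : Set ℝ) (g : ℝ → Fin N → Fin N → E) (s Δ : ℝ) :
    collisionPairSum G ε γ (S ∩ Ioc s (s + Δ)) g =
      ∑ᶠ t ∈ (collisionTimes G ε γ ∩ S) ∩ Ioc s (s + Δ), ∑ p ∈ contactPairs G ε (γ t), g t p.1 p.2 := by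
  rw [collisionPairSum, inter_assoc]

/-- **Offset averaging of collision pair sums** (integral form): if the curve `γ` has finitely many collision times in `S`
(e.g. a hard-sphere trajectory and a bounded `S`) and `Δ ≥ 0`, then
`∫ collisionPairSum G ε γ (S ∩ (s, s + Δ]) g ds = Δ • collisionPairSum G ε γ S g`. [cite: CIP1994, §4.4 p. 86] -/
theorem integral_collisionPairSum_inter_Ioc {γ : ℝ → Config N d X} {S : Set ℝ}
    (hfin : (collisionTimes G ε γ ∩ S).Finite) (g : ℝ → Fin N → Fin N → E) {Δ : ℝ} (hΔ : 0 ≤ Δ) :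
    ∫ s, collisionPairSum G ε γ (S ∩ Ioc s (s + Δ)) g = Δ • collisionPairSum G ε γ S g := by
  simp_rw [collisionPairSum_inter_Ioc]
  exact integral_finsum_mem_inter_Ioc hfin _ hΔ

/-- **Offset averaging of collision pair sums**: with finitely many collision times in `S` and `Δ > 0`,
`collisionPairSum G ε γ S g = Δ⁻¹ • ∫ collisionPairSum G ε γ (S ∩ (s, s + Δ]) g ds` — the collision sum over `S` is the
average over the window offset `s` of the collision sums over the sliding windows `(s, s + Δ]`; in a window argument each
windowed sum is then a functional of the configuration `γ s` at the window start. [cite: CIP1994, §4.4 p. 86] -/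
theorem collisionPairSum_eq_inv_smul_integral_window {γ : ℝ → Config N d X} {S : Set ℝ}
    (hfin : (collisionTimes G ε γ ∩ S).Finite) (g : ℝ → Fin N → Fin N → E) {Δ : ℝ} (hΔ : 0 < Δ) :
    collisionPairSum G ε γ S g = Δ⁻¹ • ∫ s, collisionPairSum G ε γ (S ∩ Ioc s (s + Δ)) g := by
  rw [integral_collisionPairSum_inter_Ioc hfin g hΔ.le, inv_smul_smul₀ hΔ.ne']

/-- **Offset averaging of collision pair sums over a bounded window of offsets**: with finitely many collision times in
`S ⊆ (a, b]` and `Δ > 0`, `collisionPairSum G ε γ S g = Δ⁻¹ • ∫_{s ∈ (a - Δ, b]} collisionPairSum G ε γ (S ∩ (s, s + Δ]) g ds`.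
[cite: CIP1994, §4.4 p. 86] -/
theorem collisionPairSum_eq_inv_smul_setIntegral_window {γ : ℝ → Config N d X} {S : Set ℝ}
    (hfin : (collisionTimes G ε γ ∩ S).Finite) {a b : ℝ} (hS : S ⊆ Ioc a b) (g : ℝ → Fin N → Fin N → E) {Δ : ℝ}
    (hΔ : 0 < Δ) :
    collisionPairSum G ε γ S g = Δ⁻¹ • ∫ s in Ioc (a - Δ) b, collisionPairSum G ε γ (S ∩ Ioc s (s + Δ)) g := by
  simp_rw [collisionPairSum_inter_Ioc]
  rw [setIntegral_finsum_mem_inter_Ioc hfin _ hΔ.le (fun t ht => hS ht.2), inv_smul_smul₀ hΔ.ne']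
  rfl

end Collisions

end

end Literature.Analysis.FluidPDE
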